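import Mathlib
import HarnessLib
import Summits.HubbardSuperconductivity.HubbardSuperconductivity.Theses.KLProgramme
import Summits.HubbardSuperconductivity.HubbardSuperconductivity.Theorems.KLProgrammeKLRegimeBetaSplitV7

/-!
# Route `KLProgramme` — crux K3, child 1 `KLRegimeBetaSplitV7` (stmt-HubbardSuperconductivity-19663) CLOSED BY NAME

Cell gate-hubbard-kl, seat hubbard-kl-r2d-p1 (child-1 owner).  The route item `KLRegimeBetaSplitV7 := BetaSplitP klPredsV7 klWindowC` (K3 split
gen 2, rev 10/11) is the theorem `betaSplitP_klPredsV7 klWindowC` of `…Theorems.KLProgrammeKLRegimeBetaSplitV7` (p452035): the repulsive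
s-wave cascade with scale-dependent weights (p3), extended to entrywise tail budgets and column-type sources (`sWaveCascade_envelope_sources`,
p448424) so that the thermal layer (T) and the `Q`-staged leg dressing (D/Δ15) of `PairLadderStepAtV5` are absorbed — row 0′
`pairArrayAtV2_of_engineBoundsV5S_explicit` (p451757) — then p1b's per-scale step `betaSplitAtS2_of_engineV5S` (iso endpoint line from (E5-S),
`(0,1)` value line from the pair clause, first moments from (E4)) and the constants `P(G)`, `c₀(G,P,Q)`, `U₀`, `L₁`.  One line; nothing new.
-/

namespace Summit.HubbardSuperconductivity.HubbardSuperconductivity.Theorems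

set_option linter.dupNamespace false -- summit = problem name (single-conjunct summit), D-0017

/-- **Child 1 of the K3 split holds**: `KLRegimeBetaSplitV7` (= `BetaSplitP klPredsV7 klWindowC`), by `betaSplitP_klPredsV7`. -/
theorem klRegimeBetaSplitV7_proof :
    Summit.HubbardSuperconductivity.HubbardSuperconductivity.Theses.KLProgramme.KLRegimeBetaSplitV7 :=
  KLRegimeSplit.betaSplitP_klPredsV7 KLRegimeSplit.klWindowC

end Summit.HubbardSuperconductivity.HubbardSuperconductivity.Theorems
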